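import Literature.AlgebraicGeometry.HodgeTheory.QuaternionicQuarticDoublePlaneSubstInjective
import Literature.AlgebraicGeometry.HodgeTheory.QuaternionicQuarticDeckChartBirational
import HarnessLib

/-!
# Every model of the quaternionic quartic multiple plane is birational to the DOUBLE PLANE `t² = s·α·ψ`
# (good complex parameters: `G_e(a) ≠ 0`, `a₀² ≠ a₁²`, `ψ(u₀, u₁, 1) ≠ 0`)

Layer `Literature/AlgebraicGeometry/HodgeTheory`. Theorems only; no named fact, no definition. Capstone of the «double-plane
bridge» series (`QuaternionicQuarticDoublePlaneChart` → `…ChartEquiv` → `…Coordinates` → `…Birational` → `…Integral` →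
`…SubstInjective`) of the prover seat `leafhand-hodge-q8symplecticpowers-4` (g4, cell `pub-hsemireg`) for route
`HodgeConjecture/Q8SymplecticPowers` (crux K1Q, stmt-HodgeConjecture-24190), brick **Zb-3/S1a** of the S1 programme
(`stub_regularVeryGeneralQ`: «very generally every smooth projective model of `V_(c,ψ)` has `b₁ = 0`»).

* `isDomain_deckRing_of_genericity` — at a field-valued point `φ` of the parameter ring with `φ(G_e) ≠ 0` and non-empty deck
  chart, the deck ring is a DOMAIN (the chart is an open subscheme of the integral fibre `𝒱_φ`: the tree's
  `exists_chartEmb_fibre_dominant` + `isIntegral_fiber_of_genericity`, Mathlib `isIntegral_of_isOpenImmersion`);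
* `birationalOver_spec_doublePlane_of_field` — over a FIELD, `a₀² ≠ a₁²` and `ψ(u₀, u₁, 1) ≠ 0` (with an integral non-empty
  deck chart) give `Spec (DeckRing a) ~bir Spec (DoublePlaneRing a)` over the field (the inverse `dinv = (a₀² − a₁²)⁻¹`);
* **`birationalOver_doublePlane_of_isHypersurfaceCutOutBy`** — for a complex point `φ` with `φ(G_e) ≠ 0`, non-empty deck chart,
  `a₀² ≠ a₁²` and `ψ(u₀, u₁, 1) ≠ 0`, EVERY `V` with `IsHypersurfaceCutOutBy 3 (quarticForm e (c_φ, ψ_φ)) V` is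
  `Scheme.BirationalOver` `Spec ℂ` to `Spec (DoublePlaneRing a_φ)` — the affine double plane `t² = s·α·ψ` over the rational
  surface `{c = s²σc}` (≅ the `(s, σc)`-plane, `QuaternionicQuarticDoublePlaneCoordinates`; Zariski's `z² = f(x, y)` with
  `(a₀ − a₁) f = s·y·(s² − 1)·ψ̃`). Hence every smooth projective `X` birational to `V_(c,ψ)` is birational to the double
  plane, on which the irregularity `q(X)` is Zariski's superabundance (Naie 2007 Thm. 3.1) — the shape of S1's residue in print.

Honest scope: a birational identification; the irregularity computation itself (S1b) and the genericity of the branch curve (S1c)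
are NOT here; nothing here bears on HC; S1 ∕ K1Q NOT proved.

## References

* [Zariski1929] O. Zariski, On the linear connection index of the algebraic surfaces zⁿ = f(x, y), PNAS 15 (1929).
* [Naie2007] D. Naie, The irregularity of cyclic multiple planes after Zariski, Enseign. Math. 53 (2007), §1.2, Thm. 3.1.
* [GortzWedhorn2020] U. Görtz, T. Wedhorn, Algebraic Geometry I, 2nd ed. (2020), Prop. 3.27, Prop. 4.32 (2).
* [Hartshorne1977] R. Hartshorne, Algebraic Geometry (1977), I Example 1.1.3, II Example 3.2.6.
-/

noncomputable section

open MvPolynomial CategoryTheory AlgebraicGeometry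
open Literature.AlgebraicGeometry.Motives

namespace Literature.AlgebraicGeometry.HodgeTheory.Q8Family

/-! ### Over a field: the inverse of `a₀² − a₁²` -/

section Field

universe v

variable {K : Type v} [Field K] {e : ℕ} (a : CIdx e → K)

/-- **Over a field**: `a₀² ≠ a₁²`, `ψ(u₀, u₁, 1) ≠ 0` and an integral non-empty deck chart make `Spec (DeckRing a)` and
`Spec (DoublePlaneRing a)` birational over `Spec K` (`dinv := (a₀² − a₁²)⁻¹`). [cite: GortzWedhorn2020, Prop. 4.32 (2)]
[cite: Zariski1929] -/
theorem birationalOver_spec_doublePlane_of_field [IsDomain (DeckRing a)]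
    (hdet : coefLin a 0 ^ 2 - coefLin a 1 ^ 2 ≠ 0) (hψ : ψ₂ a ≠ 0) :
    Scheme.BirationalOver (Spec.map (CommRingCat.ofHom (algebraMap K (DeckRing a))))
      (Spec.map (CommRingCat.ofHom (algebraMap K (DoublePlaneRing a)))) := by
  have hd : (coefLin a 0 ^ 2 - coefLin a 1 ^ 2) * (coefLin a 0 ^ 2 - coefLin a 1 ^ 2)⁻¹ = 1 := mul_inv_cancel₀ hdet
  have h01 : coefLin a 0 + coefLin a 1 ≠ 0 := by
    intro h
    apply hdet
    have : coefLin a 0 ^ 2 - coefLin a 1 ^ 2 = (coefLin a 0 - coefLin a 1) * (coefLin a 0 + coefLin a 1) := by ring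
    rw [this, h, mul_zero]
  exact birationalOver_spec_doublePlane' a _ hd (inv_ne_zero hdet) h01 hψ

/-- Over a field, the double-plane chart ring is a domain under the same hypotheses. [cite: Zariski1929] -/
theorem isDomain_doublePlaneRing_of_field [IsDomain (DeckRing a)]
    (hdet : coefLin a 0 ^ 2 - coefLin a 1 ^ 2 ≠ 0) (hψ : ψ₂ a ≠ 0) : IsDomain (DoublePlaneRing a) := by
  have hd : (coefLin a 0 ^ 2 - coefLin a 1 ^ 2) * (coefLin a 0 ^ 2 - coefLin a 1 ^ 2)⁻¹ = 1 := mul_inv_cancel₀ hdet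
  have h01 : coefLin a 0 + coefLin a 1 ≠ 0 := by
    intro h
    apply hdet
    have : coefLin a 0 ^ 2 - coefLin a 1 ^ 2 = (coefLin a 0 - coefLin a 1) * (coefLin a 0 + coefLin a 1) := by ring
    rw [this, h, mul_zero]
  exact isDomain_doublePlaneRing' a _ hd (inv_ne_zero hdet) h01 hψ

end Field

/-! ### Complex points: the deck ring is a domain; every model of `V_(c,ψ)` is birational to the double plane -/

section ComplexPoints

variable (e : ℕ)

/-- **The deck ring at a good field-valued point is a domain**: for `φ(G_e) ≠ 0` and a non-empty deck chart, the chart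
`Spec (DeckRing X_φ)` is an open subscheme of the integral fibre `𝒱_φ`. [cite: GortzWedhorn2020, Prop. 3.27]
[cite: Hartshorne1977, I Example 1.1.3] -/
theorem isDomain_deckRing_of_genericity {L : Type} [Field L] [Algebra (ParamRing e) L] (he : 1 ≤ e)
    (hG : algebraMap (ParamRing e) L (genericityElem e) ≠ 0)
    [Nontrivial (DeckRing (algebraMap (ParamRing e) L ∘ univCoeffs e))] :
    IsDomain (DeckRing (algebraMap (ParamRing e) L ∘ univCoeffs e)) := by
  obtain ⟨g, hg, -, -, -⟩ := exists_chartEmb_fibre_dominant e (L := L) he hG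
  haveI := isIntegral_fiber_of_genericity e (algebraMap (ParamRing e) L) he hG
  haveI := hg
  haveI := nonempty_spec_deckRing e (L := L)
  have hI := isIntegral_of_isOpenImmersion g
  exact (affine_isIntegral_iff _).mp hI

/-- **Every model of the quaternionic quartic multiple plane at a good complex parameter is birational to the double plane.**
For a complex point `φ` of the parameter ring with `φ(G_e) ≠ 0`, non-empty deck chart, `a₀² ≠ a₁²` and `ψ(u₀, u₁, 1) ≠ 0`
(`a = φ ∘ X` the coefficient vector), every `V` cut out in `ℙ³_ℂ` by the quaternionic quartic form of `(c_a, ψ_a)` is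
birational over `ℂ` to `Spec (DoublePlaneRing a)`, the double cover `t² = s·α·ψ` of the rational surface `{c = s²σc}`.
[cite: Zariski1929] [cite: Naie2007, §1.2 (normalization procedure) and Thm. 3.1] [cite: GortzWedhorn2020, Prop. 4.32 (2)] -/
theorem birationalOver_doublePlane_of_isHypersurfaceCutOutBy (φ : ParamRing e →+* ℂ) (he : 1 ≤ e)
    (hG : φ (genericityElem e) ≠ 0) [Nontrivial (DeckRing (fun i => φ (X i) : CIdx e → ℂ))]
    (hdet : coefLin (fun i => φ (X i) : CIdx e → ℂ) 0 ^ 2 - coefLin (fun i => φ (X i) : CIdx e → ℂ) 1 ^ 2 ≠ 0)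
    (hψ : ψ₂ (fun i => φ (X i) : CIdx e → ℂ) ≠ 0) {V : SchemeOver ℂ}
    (hV : IsHypersurfaceCutOutBy 3 (quarticForm e (cOf fun i => φ (X i)) (ψOf fun i => φ (X i))) V) :
    Scheme.BirationalOver
      (Spec.map (CommRingCat.ofHom (algebraMap ℂ (DoublePlaneRing (fun i => φ (X i) : CIdx e → ℂ))))) V.hom := by
  letI : Algebra (ParamRing e) ℂ := φ.toAlgebra
  haveI : Nontrivial (DeckRing (algebraMap (ParamRing e) ℂ ∘ univCoeffs e)) :=
    ‹Nontrivial (DeckRing (fun i => φ (X i) : CIdx e → ℂ))›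
  haveI : IsDomain (DeckRing (fun i => φ (X i) : CIdx e → ℂ)) :=
    isDomain_deckRing_of_genericity e (L := ℂ) he hG
  have h1 := birationalOver_deckChart_of_isHypersurfaceCutOutBy e φ he hG hV
  have h2 := birationalOver_spec_doublePlane_of_field (fun i => φ (X i) : CIdx e → ℂ) hdet hψ
  exact h2.symm.trans h1

end ComplexPoints

end Literature.AlgebraicGeometry.HodgeTheory.Q8Family

end
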